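import Literature.Computability.Complexity.CatalyticSpace
import Literature.Computability.Complexity.TimeBoundsProofs
import HarnessLib

/-!
# Catalytic machines and the classes `CSPACE s c`; `CL` as the union of its slices

A *catalytic* Turing machine (Buhrman–Cleve–Koucký–Loff–Speelman, STOC 2014) has, besides its
read-only input and a small clean work tape, an additional *auxiliary* ("catalytic", full-memory)
tape that is handed over with an ARBITRARY initial content and must be given back, bit for bit, in
that content when the machine halts — for every input and every initial content. `CSPACE(s, c)`
is the class of languages decided by such machines with work space `s` and auxiliary space `c`,
and *catalytic logspace* is `CL = CSPACE(O(log n), n^{O(1)})`; BCKLS prove `TC¹ ⊆ CL ⊆ ZPP`, and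
the relation of `CL` to `P` is open in both directions.

The class `CL` itself is `CatalyticSpace.lean` (`InCL L`, `CL = {L | InCL L}`: the fully unbundled
membership predicate over a bare `SpaceMachine` with two extra stacks, which is VERBATIM the inline
form of the route items that asked for it). This file supplies the bundled model behind it and the
general two-parameter classes, on top of the tree's space machines (`SpaceMachine`, `Space.lean`:
Mathlib's multi-stack machines `Turing.FinTM2` with a two-stack read-only input `kL`/`k₀` and the
output stack `k₁`), and proves that `CL` is the union of its `CSPACE` slices:

* `CatalyticMachine Γ₀ Γ₁` — a `SpaceMachine` with two further designated stacks `kA`, `kB`,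
  distinct from `k₀`, `k₁`, `kL` and from each other, whose alphabets are identified with `Bool`.
  They are the two halves of the catalytic tape, head between them (exactly as `kL`/`k₀` are the
  two halves of the input tape): initially `kA` holds the whole initial content `τ` and `kB` is
  empty, and *restoring the tape* means halting with `stk kA = τ`, `stk kB = []` again.
* `CatalyticMachine.catInit M x τ`, `cleanSpace`, `catSpace`, `SpaceMachine.inputOf` — the start
  configuration (the space machine's `init x`, i.e. Mathlib's `Turing.initList`, with `kA` loaded
  with `τ`); the clean space of a configuration (total length of all stacks but `k₀`, `kL`, `kA`,
  `kB` — the output stack is charged, as in `SpaceMachine.workSpace`); the number of cells on the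
  two catalytic stacks; the input word spelled by `kL`/`k₀`.
* `CatalyticDecides M L S C d` — on input `x` and for EVERY `τ : List Bool` of length `C x`: every
  configuration reachable from `catInit x τ` spells the input `x` (read-only input), has clean
  space `≤ S x` and at most `C x + d` cells on the catalytic stacks (`d` = an `O(1)` overshoot
  allowance for stack bookkeeping, invisible on a tape); and the run halts
  (`StateTransition.eval`) in a configuration whose output stack reads `[true]`/`[false]`
  according as `x ∈ L` or not, with the catalytic stacks restored. No time bound is imposed.
* `CSPACE s c` — the languages so decided with `S = s ∘ length`, `C = c ∘ length` by some machine
  and some overshoot constant (exact bounds in both arguments: Koucký–Mertz–Pyne–Sami 2025,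
  Def. 3; BCKLS Def. 14 with `O(·)` on both).
* **`mem_CL_iff_exists_CSPACE`**: `L ∈ CL ↔ ∃ k p, L ∈ CSPACE (k·log₂ n + k) (p n)` over `k : ℕ`
  and polynomials `p : Polynomial ℕ` — the tree's `CL` (KMPS Def. 4: `CL = ⋃_d CSPACE[d log n,
  n^d]`; BCKLS, Def. 14 and p. 12: "catalytic logspace `CSPACE(log n)`") is the union of its
  slices; the unbundled `InCL` merges the two constants `k` (clean space) and `d` (overshoot) of
  the bundled form into one `c = k + d`. Hence `CSPACE_subset_CL`, `CSPACE_pow_subset_CL`.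
* API: the start configuration (`inputOf_catInit`, `cleanSpace_catInit`, `catSpace_catInit`,
  `catInit_nil`), monotonicity (`CatalyticDecides.mono`, `CSPACE_mono_left`), and the answer
  clause in the `encodeBool (L.boolIndicator x)` form of `DecidesInSpace`
  (`answer_iff_eq_encodeBool`, `CatalyticDecides.exists_mem_eval_init`).

## Design notes

* Why both catalytic alphabets are pinned to `Bool`: the initial contents
  `τ.map catAlphabet.symm` must range over ALL words of length `C x` over the alphabet of `kA` (a
  larger alphabet loaded with binary `τ` would hand the machine `C x` free annotation bits, i.e.
  polynomial clean space inside `CL`), and a cell moved over to `kB` must not carry more than the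
  bit it held (BCKLS, §4, footnote 8: "the Turing machine's alphabet is assumed to be `{0, 1}`").
  The work stacks keep arbitrary finite alphabets (a constant factor in clean space).
* Exact versus big-O. BCKLS Def. 14 has `O(S)` work space and `O(S_a)` auxiliary space; KMPS
  Def. 1/3 fix both exactly (work tape of length `s`, catalytic tape of length `c ≤ 2^s`). We follow
  KMPS: `CSPACE s c` is exact in both arguments (up to the `O(1)` overshoot `d` on the catalytic
  stacks), and the constants live in `CL` (`c * Nat.log 2 n + c`, insensitive to
  `Nat.log 2 0 = Nat.log 2 1 = 0`). The side condition `c ≤ 2^s` of KMPS Def. 1 is not imposed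
  (inside `CL` it costs only the constant `k`); add it as a hypothesis where a statement needs it.
* `CL` (`CatalyticSpace.lean`) is indexed by polynomials `p : Polynomial ℕ` (Mathlib's
  `TM2ComputableInPolyTime` convention) rather than by the monomials `n^d` of KMPS Def. 4;
  `n ↦ n^d` is the polynomial `X^d` (`CSPACE_pow_subset_CL`). The converse padding of a
  polynomial catalytic tape to length `n^d` is a machine simulation that no statement here needs.
* KMPS Def. 1 starts the work tape as `0^s` and accepts by state; here the work stacks start empty
  and the answer is read off the output stack `k₁` (as for `DecidesInSpace`) — constant-overhead
  conventions. Halting is `StateTransition.eval` (reachable and `step = none`), as in `Space.lean`.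
* NOT here: the idle-stacks simulation `SpaceClass s ⊆ CSPACE s c`, `LOGSPACE ⊆ CL`
  (`CatalyticSpaceLogspace.lean`) and the constant-answer machines for `∅, univ ∈ CL`
  (`TrivialLanguagesSpace.lean`); the nondeterministic / randomized variants `CNL`, `CBPL`, `CPL`
  (KMPS Def. 2–4) and time-bounded catalytic classes; the theorems `TC¹ ⊆ CL` (BCKLS Thm. 17, for
  logspace-uniform `TC¹`, which the tree does not have) and `CL ⊆ ZPP` (BCKLS Thm. 19; the named
  fact `BCKLS2014_CL_subset_ZPP` of `CatalyticSpace.lean`).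

Mathlib has no space-bounded or catalytic computation (searched `Catalytic`, `CSPACE`, `DSPACE`,
`catalytic`: nothing); we reuse `Turing.FinTM2`, `Turing.TM2.Cfg`, `Turing.initList`,
`StateTransition.Reaches/eval`, `Function.update`, `Polynomial.eval`, `Nat.log`, and the tree's
`SpaceMachine`, `SpaceMachine.init`, `TM2Comp.initList_eq`, `CL`/`InCL`/`mem_CL_iff`.

## References

* H. Buhrman, R. Cleve, M. Koucký, B. Loff, F. Speelman, *Computing with a full memory: catalytic
  space*, STOC 2014, 857–866, doi:10.1145/2591796.2591874 [BuhrmanEtAl2014]. Locators from the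
  ECCC version TR14-053, rev. 1 (held: `paper:doi-10-1145-2591796-2591874`): §4, p. 11 (catalytic
  machines; "a language is decided by a catalytic machine if for any string `x` and any initial
  content `a` of the auxiliary tape, `M(x, a)` halts with the auxiliary tape exactly `a` and accepts
  iff `x ∈ L`"), Def. 14 (`CSPACE(S, S_a)`, `CSPACE(S) = CSPACE(S, 2^{O(S)})`), p. 12 (catalytic
  logspace), Thm. 17 (`TC¹ ⊆ CSPACE(log n)`), Thm. 19 (`CSPACE(S) ⊆ ZTIME(2^{O(S)})`, `CL ⊆ ZPP`).
* M. Koucký, I. Mertz, E. Pyne, S. Sami, *Collapsing catalytic classes*, FOCS 2025,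
  arXiv:2504.08444 [KouckyEtAl2025]: Def. 1 (catalytic machines), Def. 3 (`CSPACE[s, c]`),
  Def. 4 (`CL = ⋃_d CSPACE[d log n, n^d]`, `CNL`, `CBPL`, `CPL`).
* S. Arora, B. Barak, *Computational Complexity: A Modern Approach*, CUP 2009, Def. 4.1 (read-only
  input, work space) [AroraBarak2009].
-/

namespace Literature.Computability.Complexity

open _root_.Computability Turing StateTransition Function

variable {Γ₀ Γ₁ : Type}

/-! ### Space machines: the input spelled by a configuration, the initial stacks -/

namespace SpaceMachine

/-- The input word spelled by a configuration of a space machine: the left input stack `kL`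
(reversed) followed by the input stack `k₀`, read through the alphabet identifications — so that
`M.IsInputPreserving` says `M.inputOf c = l` along every run from `M.init l`
(`isInputPreserving_iff`). [cite: AroraBarak2009, Def. 4.1 (read-only input tape)] -/
def inputOf (M : SpaceMachine Γ₀ Γ₁) (c : M.tm.Cfg) : List Γ₀ :=
  ((c.stk M.kL).map M.leftAlphabet).reverse ++ (c.stk M.tm.k₀).map M.inputAlphabet

/-- `IsInputPreserving` in terms of `inputOf` (definitional). [folklore] -/
theorem isInputPreserving_iff (M : SpaceMachine Γ₀ Γ₁) :
    M.IsInputPreserving ↔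
      ∀ (l : List Γ₀) (c : M.tm.Cfg), Reaches M.tm.step (M.init l) c → M.inputOf c = l :=
  Iff.rfl

/-- The initial configuration starts at the main label. [folklore] -/
theorem init_l (M : SpaceMachine Γ₀ Γ₁) (l : List Γ₀) : (M.init l).l = some M.tm.main := rfl

/-- The initial configuration starts in the initial state. [folklore] -/
theorem init_var (M : SpaceMachine Γ₀ Γ₁) (l : List Γ₀) : (M.init l).var = M.tm.initialState :=
  rfl

/-- The stacks of the initial configuration: the input word on `k₀`, nothing elsewhere
(`TM2Comp.initList_eq`). [folklore] -/
theorem init_stk (M : SpaceMachine Γ₀ Γ₁) (l : List Γ₀) :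
    (M.init l).stk = update (fun _ => []) M.tm.k₀ (l.map M.inputAlphabet.symm) := by
  rw [init, TM2Comp.initList_eq]

/-- The input stack of the initial configuration holds the input word. [folklore] -/
theorem init_stk_k₀ (M : SpaceMachine Γ₀ Γ₁) (l : List Γ₀) :
    (M.init l).stk M.tm.k₀ = l.map M.inputAlphabet.symm := by
  rw [init_stk, update_self]

/-- Every other stack of the initial configuration is empty. [folklore] -/
theorem init_stk_of_ne (M : SpaceMachine Γ₀ Γ₁) (l : List Γ₀) {k : M.tm.K} (hk : k ≠ M.tm.k₀) :
    (M.init l).stk k = [] := by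
  rw [init_stk, update_of_ne hk]

/-- The initial configuration spells its input. [folklore] -/
theorem inputOf_init (M : SpaceMachine Γ₀ Γ₁) (l : List Γ₀) : M.inputOf (M.init l) = l := by
  simp [inputOf, init_stk_of_ne M l M.kL_ne_k₀, init_stk_k₀, List.map_map]

end SpaceMachine

/-! ### Catalytic machines -/

/-- A **catalytic machine**: a space machine (read-only two-stack input `kL`/`k₀`, output stack
`k₁`, `Space.lean`) together with two further designated stacks `kA`, `kB`, distinct from `k₀`,
`k₁`, `kL` and from each other, whose alphabets are identified with `Bool`. The two stacks are the
two halves of the catalytic (auxiliary, "full memory") tape with the head between them: `kA` holds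
the cell under the head and everything to its right — initially the whole initial content `τ` —
and `kB` everything to its left, reversed; both are binary so that the initial contents range over
all of `{0,1}^{c(n)}` and no cell carries more than one bit. The catalytic condition (restoring
`τ`) is part of the semantic predicate `CatalyticDecides`, not of the structure.
[cite: BuhrmanEtAl2014, §4 (catalytic Turing machine: input tape, work tape, auxiliary tape; footnote 8)] -/
structure CatalyticMachine (Γ₀ Γ₁ : Type) extends SpaceMachine Γ₀ Γ₁ where
  /-- The right half of the catalytic tape (cell under the head and to its right); initially the
  whole initial content. -/
  kA : tm.K
  /-- The left half of the catalytic tape (cells left of the head, reversed); initially empty. -/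
  kB : tm.K
  /-- The catalytic stacks are not the input stack. -/
  kA_ne_k₀ : kA ≠ tm.k₀
  /-- The catalytic stacks are not the output stack. -/
  kA_ne_k₁ : kA ≠ tm.k₁
  /-- The catalytic stacks are not the left input stack. -/
  kA_ne_kL : kA ≠ kL
  /-- The catalytic stacks are not the input stack. -/
  kB_ne_k₀ : kB ≠ tm.k₀
  /-- The catalytic stacks are not the output stack. -/
  kB_ne_k₁ : kB ≠ tm.k₁
  /-- The catalytic stacks are not the left input stack. -/
  kB_ne_kL : kB ≠ kL
  /-- The two catalytic stacks are distinct. -/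
  kA_ne_kB : kA ≠ kB
  /-- The alphabet of the right catalytic stack is binary. -/
  catAlphabet : tm.Γ kA ≃ Bool
  /-- The alphabet of the left catalytic stack is binary. -/
  retAlphabet : tm.Γ kB ≃ Bool

namespace CatalyticMachine

/-- The initial configuration of a catalytic machine on input `x` with initial catalytic content
`τ : List Bool`: the space machine's `init x` (input on `k₀`, main label, initial state, all other
stacks empty) with the stack `kA` loaded with `τ` (transported along `catAlphabet`).
[cite: BuhrmanEtAl2014, §4 (M(x, a): input x, auxiliary tape initialised to a)] -/
def catInit (M : CatalyticMachine Γ₀ Γ₁) (x : List Γ₀) (τ : List Bool) : M.tm.Cfg :=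
  ⟨(M.init x).l, (M.init x).var, update (M.init x).stk M.kA (τ.map M.catAlphabet.symm)⟩

/-- The **clean space** used by a configuration: the total length of all stacks other than the two
input stacks `k₀`, `kL` and the two catalytic stacks `kA`, `kB` (the output stack `k₁` is charged,
as in `SpaceMachine.workSpace`). [cite: KouckyEtAl2025, Def. 1 (work tape of length s)] -/
def cleanSpace (M : CatalyticMachine Γ₀ Γ₁) (c : M.tm.Cfg) : ℕ :=
  haveI := M.tm.kFin
  ∑ k ∈ (((Finset.univ.erase M.tm.k₀).erase M.kL).erase M.kA).erase M.kB, (c.stk k).length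

/-- The number of cells on the catalytic tape of a configuration: the lengths of the two catalytic
stacks together. [cite: KouckyEtAl2025, Def. 1 (catalytic tape of length c)] -/
def catSpace (M : CatalyticMachine Γ₀ Γ₁) (c : M.tm.Cfg) : ℕ :=
  (c.stk M.kA).length + (c.stk M.kB).length

section Init

variable (M : CatalyticMachine Γ₀ Γ₁) (x : List Γ₀) (τ : List Bool)

/-- The start configuration is at the main label. [folklore] -/
theorem catInit_l : (M.catInit x τ).l = some M.tm.main := rfl

/-- The start configuration is in the initial state. [folklore] -/
theorem catInit_var : (M.catInit x τ).var = M.tm.initialState := rfl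

/-- At the start the right catalytic stack holds the initial content. [folklore] -/
theorem catInit_stk_kA : (M.catInit x τ).stk M.kA = τ.map M.catAlphabet.symm := by
  simp [catInit]

/-- Away from `kA` the start configuration has the stacks of the space machine's `init x`.
[folklore] -/
theorem catInit_stk_of_ne {k : M.tm.K} (hk : k ≠ M.kA) : (M.catInit x τ).stk k = (M.init x).stk k := by
  simp [catInit, update_of_ne hk]

/-- At the start the left catalytic stack is empty. [folklore] -/
theorem catInit_stk_kB : (M.catInit x τ).stk M.kB = [] := by
  rw [catInit_stk_of_ne M x τ M.kA_ne_kB.symm, SpaceMachine.init_stk_of_ne _ _ M.kB_ne_k₀]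

/-- At the start the input stack holds the input. [folklore] -/
theorem catInit_stk_k₀ : (M.catInit x τ).stk M.tm.k₀ = x.map M.inputAlphabet.symm := by
  rw [catInit_stk_of_ne M x τ M.kA_ne_k₀.symm, SpaceMachine.init_stk_k₀]

/-- With empty initial catalytic content the start configuration is the space machine's `init x`.
[folklore] -/
theorem catInit_nil : M.catInit x [] = M.init x := by
  have hS : (M.init x).stk M.kA = [] := SpaceMachine.init_stk_of_ne _ _ M.kA_ne_k₀
  have hu : update (M.init x).stk M.kA ([] : List (M.tm.Γ M.kA)) = (M.init x).stk := by
    rw [← hS, update_eq_self]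
  change (⟨(M.init x).l, (M.init x).var, update (M.init x).stk M.kA []⟩ : M.tm.Cfg) = M.init x
  rw [hu]
  rfl

/-- The start configuration spells the input `x`. [folklore] -/
theorem inputOf_catInit : M.inputOf (M.catInit x τ) = x := by
  have hL : (M.catInit x τ).stk M.kL = [] := by
    rw [catInit_stk_of_ne M x τ M.kA_ne_kL.symm, SpaceMachine.init_stk_of_ne _ _ M.kL_ne_k₀]
  simp [SpaceMachine.inputOf, hL, catInit_stk_k₀, List.map_map]

/-- The start configuration uses no clean space. [folklore] -/
theorem cleanSpace_catInit : M.cleanSpace (M.catInit x τ) = 0 := by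
  unfold cleanSpace
  refine Finset.sum_eq_zero fun k hk => ?_
  simp only [Finset.mem_erase, Finset.mem_univ] at hk
  rw [catInit_stk_of_ne M x τ hk.2.1, SpaceMachine.init_stk_of_ne _ _ hk.2.2.2.1, List.length_nil]

/-- The start configuration has exactly `|τ|` cells on the catalytic tape. [folklore] -/
theorem catSpace_catInit : M.catSpace (M.catInit x τ) = τ.length := by
  simp [catSpace, catInit_stk_kA, catInit_stk_kB]

end Init

end CatalyticMachine

/-! ### Deciding a language catalytically -/

/-- `CatalyticDecides M L S C d`: the Boolean catalytic machine `M` decides `L` with clean space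
`S`, catalytic tape `C` and overshoot `d` — for every input `x` and EVERY initial content
`τ : List Bool` of length `C x`:
* every configuration reachable from `M.catInit x τ` spells the input `x` on `kL`/`k₀` (read-only
  input), has clean space `≤ S x`, and holds at most `C x + d` cells on the two catalytic stacks
  (`d` absorbs the `O(1)` bookkeeping overshoot of a stack implementation of one tape);
* the run halts: some `c ∈ StateTransition.eval M.tm.step (M.catInit x τ)` (reachable with
  `M.tm.step c = none`) has output stack `[true]` if `x ∈ L` and `[false]` if `x ∉ L`
  (cf. `answer_iff_eq_encodeBool`), AND the catalytic tape restored: `stk kA = τ`, `stk kB = []`.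
No time bound is imposed (BCKLS: none; the expected polynomial running time is their Thm. 19).
[cite: BuhrmanEtAl2014, §4, p. 11 (L decided by a catalytic machine: for every x and every initial auxiliary content a, M(x,a) halts with auxiliary tape exactly a and accepts iff x ∈ L) and Def. 14] -/
def CatalyticDecides (M : CatalyticMachine Bool Bool) (L : Language Bool) (S C : List Bool → ℕ)
    (d : ℕ) : Prop :=
  ∀ (x : List Bool) (τ : List Bool), τ.length = C x →
    (∀ c : M.tm.Cfg, Reaches M.tm.step (M.catInit x τ) c →
        M.inputOf c = x ∧ M.cleanSpace c ≤ S x ∧ M.catSpace c ≤ C x + d) ∧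
      ∃ c : M.tm.Cfg, c ∈ eval M.tm.step (M.catInit x τ) ∧
        (x ∈ L → (c.stk M.tm.k₁).map M.outputAlphabet = [true]) ∧
        (x ∉ L → (c.stk M.tm.k₁).map M.outputAlphabet = [false]) ∧
        c.stk M.kA = τ.map M.catAlphabet.symm ∧ c.stk M.kB = []

/-- The answer clause of `CatalyticDecides` is the output convention of `DecidesInSpace`: output
`encodeBool (L.boolIndicator x)`, i.e. `[true]` iff `x ∈ L`. [folklore] -/
theorem answer_iff_eq_encodeBool (L : Language Bool) (x : List Bool) (o : List Bool) :
    ((x ∈ L → o = [true]) ∧ (x ∉ L → o = [false])) ↔ o = encodeBool (L.boolIndicator x) := by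
  by_cases hx : x ∈ L
  · have hb : L.boolIndicator x = true := (Set.mem_iff_boolIndicator (s := L) x).1 hx
    simp [hx, hb, encodeBool]
  · have hb : L.boolIndicator x = false := (Set.notMem_iff_boolIndicator (s := L) x).1 hx
    simp [hx, hb, encodeBool]

/-- Monotonicity of `CatalyticDecides` in the clean-space bound and the overshoot. [folklore] -/
theorem CatalyticDecides.mono {M : CatalyticMachine Bool Bool} {L : Language Bool}
    {S S' C : List Bool → ℕ} {d d' : ℕ} (h : CatalyticDecides M L S C d) (hS : ∀ x, S x ≤ S' x)
    (hd : d ≤ d') : CatalyticDecides M L S' C d' := by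
  intro x τ hτ
  obtain ⟨h1, h2⟩ := h x τ hτ
  refine ⟨fun c hc => ?_, h2⟩
  obtain ⟨hi, hs, hcat⟩ := h1 c hc
  exact ⟨hi, hs.trans (hS x), hcat.trans (by omega)⟩

/-- A catalytic decider started with the EMPTY content runs its space machine from `init x`; in
particular for `C x = 0` the answer clause is about `eval M.tm.step (M.init x)`. [folklore] -/
theorem CatalyticDecides.exists_mem_eval_init {M : CatalyticMachine Bool Bool} {L : Language Bool}
    {S C : List Bool → ℕ} {d : ℕ} (h : CatalyticDecides M L S C d) (x : List Bool) (hx : C x = 0) :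
    ∃ c : M.tm.Cfg, c ∈ eval M.tm.step (M.init x) ∧
      (c.stk M.tm.k₁).map M.outputAlphabet = encodeBool (L.boolIndicator x) := by
  obtain ⟨-, c, hc, ht, hf, -, -⟩ := h x [] (by simp [hx])
  rw [CatalyticMachine.catInit_nil] at hc
  exact ⟨c, hc, (answer_iff_eq_encodeBool L x _).1 ⟨ht, hf⟩⟩

/-! ### Catalytic space classes -/

/-- `CSPACE s c`: the languages `L ⊆ {0,1}*` decided by some Boolean catalytic machine with clean
space at most `s n`, a catalytic tape of exactly `c n` arbitrary initial bits that is restored at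
the halt, and `O(1)` overshoot, on every input of length `n` (`CatalyticDecides`). Exact bounds in
both arguments (KMPS, Def. 3: "`CSPACE[s, c]`, free space `s` and catalytic space `c`"; BCKLS,
Def. 14, put `O(·)` on both — the constants are supplied by `CL`, `mem_CL_iff_exists_CSPACE`).
The KMPS side condition `c ≤ 2^s` is not imposed. [cite: KouckyEtAl2025, Def. 3 (CSPACE[s,c]); BuhrmanEtAl2014 Def. 14] -/
def CSPACE (s c : ℕ → ℕ) : Set (Language Bool) :=
  {L | ∃ (M : CatalyticMachine Bool Bool) (d : ℕ),
    CatalyticDecides M L (fun x => s x.length) (fun x => c x.length) d}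

/-- Monotonicity of `CSPACE` in the clean-space bound. [folklore] -/
theorem CSPACE_mono_left {s s' : ℕ → ℕ} (c : ℕ → ℕ) (h : ∀ n, s n ≤ s' n) :
    CSPACE s c ⊆ CSPACE s' c :=
  fun _ ⟨M, d, hM⟩ => ⟨M, d, hM.mono (fun x => h x.length) le_rfl⟩

/-- **Catalytic logspace is the union of its slices**: `L ∈ CL` (the tree's `CL = {L | InCL L}`,
`CatalyticSpace.lean`: a bare space machine with two extra designated binary stacks, ONE constant
`c` for the clean space `c·log₂|x| + c` and the overshoot, a polynomial `p` for the catalytic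
length) iff `L ∈ CSPACE (k·log₂ n + k) (p n)` for some `k : ℕ` and `p : Polynomial ℕ` (KMPS Def. 4:
`CL = ⋃_d CSPACE[d log n, n^d]`; BCKLS p. 12: catalytic logspace
`CSPACE(log n) = CSPACE(log n, 2^{O(log n)})`; see the module docstring for `p` versus `n^d`).
Bundling/unbundling is definitional; the two constants `k`, `d` of the bundled form merge into
`c = k + d`. [cite: KouckyEtAl2025, Def. 4 (CL); BuhrmanEtAl2014 Def. 14 and p. 12] -/
theorem mem_CL_iff_exists_CSPACE (L : Language Bool) :
    L ∈ CL ↔ ∃ (k : ℕ) (p : Polynomial ℕ),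
      L ∈ CSPACE (fun n => k * Nat.log 2 n + k) (fun n => p.eval n) := by
  rw [mem_CL_iff]
  constructor
  · rintro ⟨M, kA, kB, eA, eB, c, p, h₁, h₂, h₃, h₄, h₅, h₆, h₇, h⟩
    exact ⟨c, p,
      { toSpaceMachine := M, kA := kA, kB := kB, kA_ne_k₀ := h₁, kA_ne_k₁ := h₂, kA_ne_kL := h₃,
        kB_ne_k₀ := h₄, kB_ne_k₁ := h₅, kB_ne_kL := h₆, kA_ne_kB := h₇, catAlphabet := eA,
        retAlphabet := eB }, c, fun x τ hτ => h x τ hτ⟩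
  · rintro ⟨k, p, M, d, h⟩
    refine ⟨M.toSpaceMachine, M.kA, M.kB, M.catAlphabet, M.retAlphabet, k + d, p, M.kA_ne_k₀,
      M.kA_ne_k₁, M.kA_ne_kL, M.kB_ne_k₀, M.kB_ne_k₁, M.kB_ne_kL, M.kA_ne_kB, fun x τ hτ => ?_⟩
    obtain ⟨h1, h2⟩ := h x τ hτ
    refine ⟨fun cfg hc => ?_, h2⟩
    obtain ⟨hi, hs, hcat⟩ := h1 cfg hc
    dsimp only at hs hcat
    refine ⟨hi, ?_, ?_⟩
    · change M.cleanSpace cfg ≤ (k + d) * Nat.log 2 x.length + (k + d)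
      exact hs.trans
        (add_le_add (Nat.mul_le_mul_right _ (Nat.le_add_right k d)) (Nat.le_add_right k d))
    · change M.catSpace cfg ≤ p.eval x.length + (k + d)
      omega

/-- The slices of `CL`. [cite: KouckyEtAl2025, Def. 4] -/
theorem CSPACE_subset_CL (k : ℕ) (p : Polynomial ℕ) :
    CSPACE (fun n => k * Nat.log 2 n + k) (fun n => p.eval n) ⊆ CL :=
  fun L hL => (mem_CL_iff_exists_CSPACE L).2 ⟨k, p, hL⟩

/-- The monomial slices `CSPACE[k log n + k, n^d] ⊆ CL` of KMPS Def. 4 (`n^d = (X^d).eval n`).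
[cite: KouckyEtAl2025, Def. 4 (CL = ⋃_d CSPACE[d log n, n^d])] -/
theorem CSPACE_pow_subset_CL (k d : ℕ) :
    CSPACE (fun n => k * Nat.log 2 n + k) (fun n => n ^ d) ⊆ CL := by
  intro L hL
  refine CSPACE_subset_CL k (Polynomial.X ^ d) ?_
  simpa using hL

end Literature.Computability.Complexity
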